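import Literature.NumberTheory.DiophantineGeometry.AbcWave0
import HarnessLib

/-!
# Power-saving bounds for the exceptional set in the abc conjecture

Topic `NumberTheory/DiophantineGeometry`; companion of
`Literature.NumberTheory.DiophantineGeometry.AbcWave0` (abc triples `IsABCTriple`, the radical
`rad`, the hit count `abcHitCount`).

For a real exponent `λ` and `X ∈ ℕ` let `N_λ(X)` (`abcExponentCount λ X` below) be the number of
*abc triples of exponent `λ`* up to `X`: triples `(a, b, c) ∈ ℕ³` with `gcd(a, b, c) = 1`,
`a + b = c` and `rad(abc) < c ^ λ`, counted in the box `[1, X]³`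
[cite: BernertEtAl2024, §1]. (For positive `a + b = c`, "`(a, b, c) ∈ [1, X]³`" is "`c ≤ X`", and
"`gcd(a, b, c) = 1`" is "`gcd(a, b) = 1`", so this is the set of `IsABCTriple a b c` with `c ≤ X` and
`rad(abc) < c ^ λ`; at `λ = 1` it is literally `abcHitCount X`, see `abcExponentCount_one`.) The abc
conjecture says that `N_λ(X)` is bounded for every `λ < 1`; the "trivial bound" is
`N_λ(X) ≪_ε X ^ (2λ/3 + ε)` [cite: BernertEtAl2024, Prop. 1.1], proved in this tree at `λ = 1`
(`ABCHitCountUpperBound_holds` in `AbcHitCountUpperBoundProofs`).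

## What is vendored (named facts, not proved here)

C. Bernert, T. Browning, J. D. Lichtman, J. Teräväinen, *Bounds on the exceptional set in the abc
conjecture*, arXiv:2410.12234, **version 2 of 9 May 2026** (four authors; it "merges an earlier
article of the last three authors [v1, 16 Oct 2024] … together with its subsequent improvement and
simplification by the first author [Bernert, arXiv:2506.13364]"):

> **Theorem 1.2.** Let `λ ∈ (0, 2]`. For any `ε > 0`, we have `N_λ(X) ≪_ε X^{(23λ+3)/40+ε}`.
> In particular, we have `N_λ(X) ≪_λ X^{0.65}`, if `λ ∈ (0, 1)`.

> **Theorem 1.3.** Let `λ ∈ (0, 1)`. Then `N_λ(X) ≪_{ε,λ} X^{0.6+ε}`, for any `ε > 0`.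

These are `bernertEtAl2024_thm_1_2` and `bernertEtAl2024_thm_1_3`. The proofs (a factorisation
of `a, b, c` into "shapes" `∏ x_j^j`, Prop. 2.1; a Fourier-analytic fourth-moment bound, Prop. 3.1;
a geometry-of-numbers bound, Prop. 4.1; §5 for Theorem 1.2; and for Theorem 1.3 a mixed-integer
linear program over the two bounds, Prop. 6.1 with Python code in Appendix A) are not reproduced;
both statements are recorded as named facts
(`def … : Prop`), to be consumed as hypotheses `(h : bernertEtAl2024_thm_1_2)`.

Design of the Lean statements. `≪` with `X → ∞` is rendered as "`∃ C, ∀ X ≥ 2, N_λ(X) ≤ C · X^θ`"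
(the same shape as `ABCHitCountUpperBound`; since `N_λ(X)` is finite for each `X` and `X^θ > 0`,
this is equivalent to an eventual bound). In `bernertEtAl2024_thm_1_2` the constant is allowed to
depend on `λ` as well as `ε` (the quantifier order `∀ λ, ∀ ε, ∃ C`); the form with a constant
uniform in `λ ∈ (0, 2]`, which is how `≪_ε` reads literally, is *equivalent* and is PROVED from it
here (`bernertEtAl2024_thm_1_2.uniform`: monotonicity of `N_λ` in `λ` and a finite grid of
exponents), so nothing is lost and nothing stronger than the printed theorem is asserted.

## What is proved here

* API of `abcExponentCount`: finiteness of the underlying set, `N_1(X) = abcHitCount X`,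
  monotonicity in `λ` and in `X`, and `N_λ(X) = 0` for `λ ≤ 0`.
* Consequences of `bernertEtAl2024_thm_1_2` (all by monotonicity in `λ` and arithmetic of
  exponents), which are exactly the earlier published records, so that none of them needs its own
  named fact:
  - the uniform-in-`λ` form (`.uniform`);
  - at `λ = 1`: `abcHitCount X ≪_ε X^{13/20+ε}` (`.abcHitCount_le`);
  - the "in particular" clause `N_λ(X) ≪_λ X^{0.65}` for `λ ∈ (0, 1)` (`.of_lt_one`);
  - C. Bernert, arXiv:2506.13364 (2025), Theorem 1: the same bound for `λ ∈ (0, 2)` (`.bernert2025`)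
    [cite: Bernert2025, Thm. 1];
  - version 1 of the paper (Browning–Lichtman–Teräväinen, 16 Oct 2024), Theorem 1.2:
    `N_λ(X) = O(X^{33/50})` for fixed `λ ∈ (0, 1.001)` (`.version1`), because
    `(23 · 1.001 + 3)/40 = 0.650575 < 0.66` [cite: BernertEtAl2024, Thm. 1.2 (arXiv v1)];
  - R. Li, arXiv:2507.02885 (2025), Theorem 1.3: for every `ε > 0` there is `δ = δ(ε) > 0` with
    `N_λ(X) ≪ X^{56/85+ε}` for `0 < λ < 1 + δ` (`.li2025`), because `13/20 < 56/85`
    [cite: Li2025ExceptionalSet, Thm. 1.3].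

## References

* [BernertEtAl2024] C. Bernert, T. Browning, J. D. Lichtman, J. Teräväinen, *Bounds on the
  exceptional set in the abc conjecture*, arXiv:2410.12234; v1 (Browning–Lichtman–Teräväinen)
  16 Oct 2024: Prop. 1.1, Thm. 1.2 (`33/50`); v2 9 May 2026: Prop. 1.1, Thm. 1.2, Thm. 1.3,
  Props. 2.1, 3.1, 4.1.
* [Bernert2025] C. Bernert, *The exceptional set in the abc conjecture*, arXiv:2506.13364 (2025),
  Theorem 1, Propositions 2–3.
* [Li2025ExceptionalSet] R. Li, *On the exceptional set in the abc conjecture*, arXiv:2507.02885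
  (2025), Theorem 1.3.
-/

noncomputable section

open Finset

namespace Literature.NumberTheory.DiophantineGeometry

/-! ### The counting function `N_λ(X)` -/

/-- `N_λ(X)`, the number of *abc triples of exponent `l`* up to `X`: abc triples `(a, b, c)`
(positive, coprime, `a + b = c`) with `c ≤ X` and `rad(abc) < c ^ l` (real power). The set is
finite (`abcExponentCount_finite`), so `Set.ncard` is an honest cardinality. For `l = 1` this is
`abcHitCount X` (`abcExponentCount_one`); for `l ≤ 0` it is `0` (`abcExponentCount_eq_zero_of_nonpos`).
[cite: BernertEtAl2024, §1] -/
def abcExponentCount (l : ℝ) (X : ℕ) : ℕ :=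
  {t : ℕ × ℕ × ℕ | IsABCTriple t.1 t.2.1 t.2.2 ∧ t.2.2 ≤ X ∧
    ((rad t.1 t.2.1 t.2.2 : ℕ) : ℝ) < (t.2.2 : ℝ) ^ l}.ncard

/-- Unfolding lemma for `abcExponentCount`. [folklore] -/
theorem abcExponentCount_def (l : ℝ) (X : ℕ) :
    abcExponentCount l X = {t : ℕ × ℕ × ℕ | IsABCTriple t.1 t.2.1 t.2.2 ∧ t.2.2 ≤ X ∧
      ((rad t.1 t.2.1 t.2.2 : ℕ) : ℝ) < (t.2.2 : ℝ) ^ l}.ncard :=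
  rfl

/-- The abc triples of exponent `l` up to `X` lie in `[0, X]³`, so they form a finite set.
[folklore] -/
theorem abcExponentCount_finite (l : ℝ) (X : ℕ) :
    {t : ℕ × ℕ × ℕ | IsABCTriple t.1 t.2.1 t.2.2 ∧ t.2.2 ≤ X ∧
      ((rad t.1 t.2.1 t.2.2 : ℕ) : ℝ) < (t.2.2 : ℝ) ^ l}.Finite := by
  refine ((Set.finite_Iic X).prod ((Set.finite_Iic X).prod (Set.finite_Iic X))).subset ?_
  rintro ⟨a, b, c⟩ ⟨⟨ha, hb, habc, -⟩, hcX, -⟩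
  simp only [Set.mem_prod, Set.mem_Iic] at *
  omega

/-- At exponent `1`, `N_1(X)` is the number of abc hits `abcHitCount X` of `AbcWave0`
(`rad(abc) < c`). [folklore] -/
theorem abcExponentCount_one (X : ℕ) : abcExponentCount 1 X = abcHitCount X := by
  rw [abcExponentCount, abcHitCount]
  congr 1
  ext t
  simp only [Set.mem_setOf_eq, Real.rpow_one, Nat.cast_lt]

/-- `N_λ(X)` is monotone in the exponent: `rad(abc) < c ^ l ≤ c ^ m` for `l ≤ m`, as `c ≥ 1`.
[folklore] -/
theorem abcExponentCount_mono_left {l m : ℝ} (h : l ≤ m) (X : ℕ) :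
    abcExponentCount l X ≤ abcExponentCount m X := by
  rw [abcExponentCount, abcExponentCount]
  refine Set.ncard_le_ncard ?_ (abcExponentCount_finite m X)
  rintro ⟨a, b, c⟩ ⟨ht, hcX, hlt⟩
  refine ⟨ht, hcX, hlt.trans_le (Real.rpow_le_rpow_of_exponent_le ?_ h)⟩
  obtain ⟨ha, hb, habc, -⟩ := ht
  exact_mod_cast (show 1 ≤ c by simp only at habc; omega)

/-- `N_λ(X)` is monotone in `X`. [folklore] -/
theorem abcExponentCount_mono_right (l : ℝ) {X Y : ℕ} (h : X ≤ Y) :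
    abcExponentCount l X ≤ abcExponentCount l Y := by
  rw [abcExponentCount, abcExponentCount]
  refine Set.ncard_le_ncard ?_ (abcExponentCount_finite l Y)
  rintro t ⟨ht, hcX, hlt⟩
  exact ⟨ht, hcX.trans h, hlt⟩

/-- For `l ≤ 0` there are no abc triples of exponent `l`: `c ^ l ≤ 1 ≤ rad(abc)`. [folklore] -/
theorem abcExponentCount_eq_zero_of_nonpos {l : ℝ} (hl : l ≤ 0) (X : ℕ) :
    abcExponentCount l X = 0 := by
  rw [abcExponentCount, Set.ncard_eq_zero (abcExponentCount_finite l X),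
    Set.eq_empty_iff_forall_notMem]
  rintro ⟨a, b, c⟩ ⟨⟨ha, hb, habc, -⟩, -, hlt⟩
  simp only at habc hlt
  have hc1 : (1 : ℝ) ≤ c := by exact_mod_cast (show 1 ≤ c by omega)
  have hrad : (1 : ℝ) ≤ (rad a b c : ℕ) := by
    exact_mod_cast Nat.one_le_iff_ne_zero.mpr
      (by rw [rad_def]; exact UniqueFactorizationMonoid.radical_ne_zero)
  exact absurd (hlt.trans_le (Real.rpow_le_one_of_one_le_of_nonpos hc1 hl)) (not_lt.mpr hrad)

/-! ### The named facts (Bernert–Browning–Lichtman–Teräväinen, arXiv v2, 2026) -/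

/-- **Bernert–Browning–Lichtman–Teräväinen, Theorem 1.2** (arXiv:2410.12234 v2, 9 May 2026):
"Let `λ ∈ (0, 2]`. For any `ε > 0`, we have `N_λ(X) ≪_ε X^{(23λ+3)/40+ε}`." Rendered with a
constant depending on `λ` and `ε` and the bound for all `X ≥ 2`; the uniform-in-`λ` reading is
equivalent and is derived in `bernertEtAl2024_thm_1_2.uniform`. At `λ = 1` the exponent is
`13/20 = 0.65` (`bernertEtAl2024_thm_1_2.abcHitCount_le`). Also Theorem 1 of Bernert,
arXiv:2506.13364 (there for `λ ∈ (0, 2)`). A named fact, not proved here (shape factorisation,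
Fourier fourth moment, geometry of numbers: Props. 2.1, 3.1, 4.1 and §5 of the source).
[cite: BernertEtAl2024, Thm. 1.2 (arXiv v2)] -/
def bernertEtAl2024_thm_1_2 : Prop :=
  ∀ l : ℝ, 0 < l → l ≤ 2 → ∀ ε : ℝ, 0 < ε → ∃ C : ℝ, ∀ X : ℕ, 2 ≤ X →
    (abcExponentCount l X : ℝ) ≤ C * (X : ℝ) ^ ((23 * l + 3) / 40 + ε)

/-- **Bernert–Browning–Lichtman–Teräväinen, Theorem 1.3** (arXiv:2410.12234 v2, 9 May 2026):
"Let `λ ∈ (0, 1)`. Then `N_λ(X) ≪_{ε,λ} X^{0.6+ε}`, for any `ε > 0`." The constant depends on `λ`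
and `ε` as printed; `λ = 1` is NOT covered. A named fact, not proved here (a mixed-integer
linear program over the bounds of Props. 3.1 and 4.1: Prop. 6.1, with the Python code in
Appendix A of the source).
[cite: BernertEtAl2024, Thm. 1.3 (arXiv v2)] -/
def bernertEtAl2024_thm_1_3 : Prop :=
  ∀ l : ℝ, 0 < l → l < 1 → ∀ ε : ℝ, 0 < ε → ∃ C : ℝ, ∀ X : ℕ, 2 ≤ X →
    (abcExponentCount l X : ℝ) ≤ C * (X : ℝ) ^ (3 / 5 + ε : ℝ)

/-! ### Consequences of Theorem 1.2: the earlier records and the uniform form -/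

/-- Transport of a power bound along monotonicity: if `N_m(X) ≤ C X^e` for `X ≥ 2`, `l ≤ m` and
`e ≤ e'`, then `N_l(X) ≤ max C 0 · X^{e'}` for `X ≥ 2`. [folklore] -/
theorem abcExponentCount_le_of_le {l m C e e' : ℝ} (hlm : l ≤ m) (he : e ≤ e')
    (hC : ∀ X : ℕ, 2 ≤ X → (abcExponentCount m X : ℝ) ≤ C * (X : ℝ) ^ e) (X : ℕ) (hX : 2 ≤ X) :
    (abcExponentCount l X : ℝ) ≤ max C 0 * (X : ℝ) ^ e' := by
  have hX1 : (1 : ℝ) ≤ X := by exact_mod_cast (show 1 ≤ X by omega)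
  have hXe : 0 ≤ (X : ℝ) ^ e := Real.rpow_nonneg (by positivity) e
  calc (abcExponentCount l X : ℝ) ≤ abcExponentCount m X := by
        exact_mod_cast abcExponentCount_mono_left hlm X
    _ ≤ C * (X : ℝ) ^ e := hC X hX
    _ ≤ max C 0 * (X : ℝ) ^ e := mul_le_mul_of_nonneg_right (le_max_left _ _) hXe
    _ ≤ max C 0 * (X : ℝ) ^ e' :=
        mul_le_mul_of_nonneg_left (Real.rpow_le_rpow_of_exponent_le hX1 he) (le_max_right _ _)

namespace bernertEtAl2024_thm_1_2

/-- **Theorem 1.2 at `λ = 1`**: `N(X) = abcHitCount X ≪_ε X^{13/20 + ε}` — the record at the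
endpoint `λ = 1` (where Theorem 1.3 does not apply), improving the trivial `2/3`.
[cite: BernertEtAl2024, Thm. 1.2 (arXiv v2)] -/
theorem abcHitCount_le (h : bernertEtAl2024_thm_1_2) :
    ∀ ε : ℝ, 0 < ε → ∃ C : ℝ, ∀ X : ℕ, 2 ≤ X →
      (abcHitCount X : ℝ) ≤ C * (X : ℝ) ^ (13 / 20 + ε : ℝ) := by
  intro ε hε
  obtain ⟨C, hC⟩ := h 1 one_pos (by norm_num) ε hε
  refine ⟨C, fun X hX => ?_⟩
  have h1 := hC X hX
  have he : ((23 : ℝ) * 1 + 3) / 40 + ε = 13 / 20 + ε := by norm_num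
  rwa [abcExponentCount_one, he] at h1

/-- **Theorem 1.2, "in particular" clause**: for fixed `λ ∈ (0, 1)`, `N_λ(X) ≪_λ X^{0.65}`
(take `ε = 23(1 − λ)/40`). [cite: BernertEtAl2024, Thm. 1.2 (arXiv v2)] -/
theorem of_lt_one (h : bernertEtAl2024_thm_1_2) {l : ℝ} (hl : 0 < l) (hl1 : l < 1) :
    ∃ C : ℝ, ∀ X : ℕ, 2 ≤ X → (abcExponentCount l X : ℝ) ≤ C * (X : ℝ) ^ (13 / 20 : ℝ) := by
  obtain ⟨C, hC⟩ := h l hl (by linarith) (23 * (1 - l) / 40) (by linarith)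
  have he : ((23 : ℝ) * l + 3) / 40 + 23 * (1 - l) / 40 = 13 / 20 := by ring
  refine ⟨C, fun X hX => ?_⟩
  have h1 := hC X hX
  rwa [he] at h1

/-- **Bernert 2025, Theorem 1** (arXiv:2506.13364): for `λ ∈ (0, 2)`,
`N_λ(X) ≪ X^{(23λ+3)/40+ε}` — the case `λ < 2` of Theorem 1.2 of the merged paper.
[cite: Bernert2025, Thm. 1] -/
theorem bernert2025 (h : bernertEtAl2024_thm_1_2) :
    ∀ l : ℝ, 0 < l → l < 2 → ∀ ε : ℝ, 0 < ε → ∃ C : ℝ, ∀ X : ℕ, 2 ≤ X →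
      (abcExponentCount l X : ℝ) ≤ C * (X : ℝ) ^ ((23 * l + 3) / 40 + ε) :=
  fun l hl hl2 ε hε => h l hl hl2.le ε hε

/-- **Browning–Lichtman–Teräväinen 2024 (arXiv v1), Theorem 1.2**: for fixed `λ ∈ (0, 1.001)`,
`N_λ(X) = O(X^{33/50})`. It follows from Theorem 1.2 of v2 at `λ = 1.001` with
`ε = 33/50 − (23 · 1.001 + 3)/40 = 0.009425` and monotonicity in `λ` (the hypothesis `0 < λ` of
the source is not needed: `N_λ(X) = 0` for `λ ≤ 0`). [cite: BernertEtAl2024, Thm. 1.2 (arXiv v1)] -/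
theorem version1 (h : bernertEtAl2024_thm_1_2) {l : ℝ} (hl1 : l < 1.001) :
    ∃ C : ℝ, ∀ X : ℕ, 2 ≤ X → (abcExponentCount l X : ℝ) ≤ C * (X : ℝ) ^ (33 / 50 : ℝ) := by
  obtain ⟨C, hC⟩ := h 1.001 (by norm_num) (by norm_num) (33 / 50 - (23 * 1.001 + 3) / 40)
    (by norm_num)
  exact ⟨max C 0, abcExponentCount_le_of_le hl1.le (by norm_num) hC⟩

/-- **Li 2025, Theorem 1.3** (arXiv:2507.02885): for every `ε > 0` there is `δ = δ(ε) > 0` such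
that `N_λ(X) ≪ X^{56/85+ε}` whenever `0 < λ < 1 + δ` (here even with one constant for all such
`λ`). It follows from Theorem 1.2 of v2 at `λ = 1 + δ`, `δ = 6/391`, where the exponent is
`13/20 + 3/340 = 56/85`, and monotonicity in `λ`. [cite: Li2025ExceptionalSet, Thm. 1.3] -/
theorem li2025 (h : bernertEtAl2024_thm_1_2) :
    ∀ ε : ℝ, 0 < ε → ∃ δ : ℝ, 0 < δ ∧ ∃ C : ℝ, ∀ l : ℝ, 0 < l → l < 1 + δ → ∀ X : ℕ, 2 ≤ X →
      (abcExponentCount l X : ℝ) ≤ C * (X : ℝ) ^ (56 / 85 + ε : ℝ) := by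
  intro ε hε
  obtain ⟨C, hC⟩ := h (1 + 6 / 391) (by norm_num) (by norm_num) ε hε
  refine ⟨6 / 391, by norm_num, max C 0, fun l _ hl X hX => ?_⟩
  exact abcExponentCount_le_of_le hl.le (le_of_eq (by ring)) hC X hX

/-- **Theorem 1.2 with a constant uniform in `λ ∈ (0, 2]`** (the literal reading of `≪_ε`),
derived from the per-`λ` statement: choose `N > 23/(10ε)`, apply the fact at the grid points
`2(i+1)/N` (`i < N`) with `ε/2`, and bound `N_λ` by `N_{λ'}` at the grid point `λ'` just above
`λ`, whose exponent exceeds `(23λ+3)/40 + ε/2` by at most `23 · 2/(40N) ≤ ε/2`.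
[cite: BernertEtAl2024, Thm. 1.2 (arXiv v2)] -/
theorem uniform (h : bernertEtAl2024_thm_1_2) :
    ∀ ε : ℝ, 0 < ε → ∃ C : ℝ, ∀ l : ℝ, 0 < l → l ≤ 2 → ∀ X : ℕ, 2 ≤ X →
      (abcExponentCount l X : ℝ) ≤ C * (X : ℝ) ^ ((23 * l + 3) / 40 + ε) := by
  intro ε hε
  -- the grid
  set N : ℕ := ⌈23 / (10 * ε)⌉₊ + 1 with hN
  have hN0 : 0 < N := Nat.succ_pos _
  have hN0' : (0 : ℝ) < N := by exact_mod_cast hN0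
  have hNε : 23 / (20 * (N : ℝ)) ≤ ε / 2 := by
    have h1 : 23 / (10 * ε) ≤ ⌈23 / (10 * ε)⌉₊ := Nat.le_ceil _
    have h2 : (⌈23 / (10 * ε)⌉₊ : ℝ) + 1 = N := by simp [hN]
    rw [div_le_iff₀ (by positivity)]
    have h3 : 23 / (10 * ε) * (10 * ε) = 23 := div_mul_cancel₀ _ (by positivity)
    nlinarith
  -- grid exponents and their constants
  set g : ℕ → ℝ := fun i => min 2 (2 * (i + 1) / N) with hg
  have hg_pos : ∀ i, 0 < g i := fun i => lt_min two_pos (by positivity)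
  have hg_le : ∀ i, g i ≤ 2 := fun i => min_le_left _ _
  choose C hC using fun i => h (g i) (hg_pos i) (hg_le i) (ε / 2) (half_pos hε)
  refine ⟨∑ i ∈ range N, max (C i) 0, fun l hl hl2 X hX => ?_⟩
  -- the grid point just above `l`
  have hceil_pos : 0 < ⌈l * N / 2⌉₊ := Nat.ceil_pos.mpr (by positivity)
  have hceil_le : ⌈l * N / 2⌉₊ ≤ N := Nat.ceil_le.mpr (by nlinarith)
  set i : ℕ := ⌈l * N / 2⌉₊ - 1 with hi
  have hi1 : ((i + 1 : ℕ) : ℝ) = ⌈l * N / 2⌉₊ := by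
    rw [hi, Nat.sub_add_cancel hceil_pos]
  have hiN : i < N := by omega
  have hl_le : l ≤ g i := by
    refine le_min hl2 ?_
    rw [le_div_iff₀ hN0', show (2 : ℝ) * (i + 1) = 2 * ((i + 1 : ℕ) : ℝ) by push_cast; ring, hi1]
    have := Nat.le_ceil (l * N / 2)
    linarith
  have hg_lt : g i < l + 2 / N := by
    refine (min_le_right _ _).trans_lt ?_
    rw [show (2 : ℝ) * (i + 1) = 2 * ((i + 1 : ℕ) : ℝ) by push_cast; ring, hi1,
      div_lt_iff₀ hN0', add_mul, div_mul_cancel₀ _ hN0'.ne']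
    have := Nat.ceil_lt_add_one (show 0 ≤ l * N / 2 by positivity)
    linarith
  have hexp : (23 * g i + 3) / 40 + ε / 2 ≤ (23 * l + 3) / 40 + ε := by
    have h2N : 23 * (2 / (N : ℝ)) / 40 = 23 / (20 * N) := by ring
    nlinarith
  calc (abcExponentCount l X : ℝ) ≤ max (C i) 0 * (X : ℝ) ^ ((23 * l + 3) / 40 + ε) :=
        abcExponentCount_le_of_le hl_le hexp (hC i) X hX
    _ ≤ (∑ j ∈ range N, max (C j) 0) * (X : ℝ) ^ ((23 * l + 3) / 40 + ε) := by
        gcongr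
        exact single_le_sum (f := fun j => max (C j) 0) (fun j _ => le_max_right _ _)
          (mem_range.mpr hiN)

end bernertEtAl2024_thm_1_2

end Literature.NumberTheory.DiophantineGeometry
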